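import Summits.CriticalPhenomena.PercolationContinuityZ3.Theorems.PercNearOneGluingNoHeavyQuantTwoBigCellLLC4B1
import Summits.CriticalPhenomena.PercolationContinuityZ3.Theorems.PercNearOneGluingNoHeavyQuantTwoBigCellLLC4B2
import Summits.CriticalPhenomena.PercolationContinuityZ3.Theorems.PercNearOneGluingNoHeavyQuantTwoBigCellLLC4B0
import HarnessLib

/-!
# QUANT lane R8, Conjecture DIB\* — the two-big certificate, cell `LL/C4`

builds on p205010 (kernel theorem, internal audit signed; external expert review pending)

Support file (`--supports stmt-CriticalPhenomena-4575`), QUANT lane census-1 (gen 17); memo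
`run/shared/lean/prim/quant/prim-quant-census-1/TWOBIG-G17.md`.  Theorems only, no definitions, no sorries, standard axioms.
Coordinates `y = 1 − x`, `uᵢ = αᵢφᵢ`, `vᵢ = αᵢ(1 − φᵢ)` (`αᵢ = bᵢ/j`, `φᵢ` = credit rate of big `i`); the three `tbcBlock_*` lemmas are
LP-found Handelman certificates (products of the cell's defining inequalities, replayed by `linarith`) of a separable budget split
`c₁ + c₂ + c₀ = (1−y)α₁α₂ − P₁P₂`, `cₖ·Dₖ ≤ Bₖ·Nₖ`; `tbcCell_*` combines them into the reduced inequality of the cell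
(items in product form).  [this work]; the gluing rows served [cite: KozmaNitzan2024, Conjecture 3 (p. 15)].
-/

namespace Summit.CriticalPhenomena.PercolationContinuityZ3.Theorems

namespace Quant

namespace IndepBlob

set_option maxHeartbeats 1000000 in
/-- **Two-big cell `LL/C4`**: the reduced inequality from the three blocks (items in product form `N ≤ t·D`). [this work] -/
theorem tbcCell_LL_C4 (y u₁ v₁ u₂ v₂ t₁ t₂ t₀ : ℝ) (hy0 : 0 < y) (hhy : y ≤ 1 / 2) (hu1 : 0 ≤ u₁) (hv1 : 0 ≤ v₁) (hu2 : 0 ≤ u₂) (hv2 : 0 ≤ v₂)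
    (ha1 : u₁ + v₁ ≤ 1) (_hb1 : 1 / 2 ≤ u₁ + v₁) (_ha2 : u₂ + v₂ ≤ 1) (hb2 : 1 / 2 ≤ u₂ + v₂) (ht1 : 0 ≤ (1 - y) * v₁ - u₁ * y)
    (ht2 : 0 ≤ (1 - y) * v₂ - u₂ * y) (hr2 : 0 ≤ (2 - y) * (1 - u₂ - v₂) - (2 - u₁ - u₂)) (hct : 0 < (2 - u₁ - u₂))
    (hT1 : (1 + v₁ - u₂) ^ 2 ≤ t₁ * (y * (2 - u₁ - u₂) + (1 + v₁ - u₂) ^ 2))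
    (hT2 : ((1 - y) * (1 + v₂ - u₁)) ≤ t₂ * ((2 - u₁ - u₂) - (1 - y) * (1 - u₂ - v₂))) (hT0 : 0 ≤ t₀) :
    (1 - y) * ((u₁ + v₁) * (u₂ + v₂))
      ≤ ((u₁ + v₁) * (1 - y) ^ 2 + y * u₁) * ((u₂ + v₂) * (1 - y) ^ 2 + y * u₂) + ((u₁ + v₁) * (1 - y) ^ 2 + y * u₁) * (y * ((u₂ + v₂) * (2 - y) -
            u₂)) * t₁ + (y * ((u₁ + v₁) * (2 - y) - u₁)) * ((u₂ + v₂) * (1 - y) ^ 2 + y * u₂) * t₂ + (y * ((u₁ + v₁) * (2 - y) - u₁)) * (y * ((u₂ +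
            v₂) * (2 - y) - u₂)) * t₀ := by
  have b1 := tbcBlock_LL_C4_1 y u₁ v₁ u₂ v₂ hy0.le (by linarith) hu1 hv1 hu2 hv2 (by linarith) (by linarith) (by linarith) (by linarith) ht1 ht2 hr2
  have b2 := tbcBlock_LL_C4_2 y u₁ v₁ u₂ v₂ hy0.le (by linarith) hu1 hv1 hu2 hv2 (by linarith) (by linarith) (by linarith) (by linarith) ht1 ht2 hr2
  have b0 := tbcBlock_LL_C4_0 y u₁ v₁ u₂ v₂ hy0.le (by linarith) hu1 hv1 hu2 hv2 (by linarith) (by linarith) (by linarith) (by linarith) ht1 ht2 hr2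
  have hD1 : (0:ℝ) < (y * (2 - u₁ - u₂) + (1 + v₁ - u₂) ^ 2) := by
    have h1 := mul_pos hy0 hct
    have h2 := sq_nonneg (1 + v₁ - u₂)
    linarith
  have hD2 : (0:ℝ) < ((2 - u₁ - u₂) - (1 - y) * (1 - u₂ - v₂)) := by
    have h1 := mul_pos hy0 hct
    have h2 : (0:ℝ) ≤ (1 - y) * (1 + v₂ - u₁) := mul_nonneg (by linarith) (by linarith)
    linarith
  have hP1 : (0:ℝ) ≤ ((u₁ + v₁) * (1 - y) ^ 2 + y * u₁) := by
    have h1 := mul_nonneg (show (0:ℝ) ≤ u₁ + v₁ by linarith) (sq_nonneg (1 - y))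
    have h2 := mul_nonneg hy0.le hu1
    linarith
  have hQt1 : (0:ℝ) ≤ ((u₁ + v₁) * (2 - y) - u₁) := by
    have h1 := mul_nonneg (show (0:ℝ) ≤ 1 - y by linarith) (show (0:ℝ) ≤ u₁ + v₁ by linarith)
    linarith
  have hQ1 : (0:ℝ) ≤ (y * ((u₁ + v₁) * (2 - y) - u₁)) := mul_nonneg hy0.le hQt1
  have hP2 : (0:ℝ) ≤ ((u₂ + v₂) * (1 - y) ^ 2 + y * u₂) := by
    have h1 := mul_nonneg (show (0:ℝ) ≤ u₂ + v₂ by linarith) (sq_nonneg (1 - y))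
    have h2 := mul_nonneg hy0.le hu2
    linarith
  have hQt2 : (0:ℝ) ≤ ((u₂ + v₂) * (2 - y) - u₂) := by
    have h1 := mul_nonneg (show (0:ℝ) ≤ 1 - y by linarith) (show (0:ℝ) ≤ u₂ + v₂ by linarith)
    linarith
  have hQ2 : (0:ℝ) ≤ (y * ((u₂ + v₂) * (2 - y) - u₂)) := mul_nonneg hy0.le hQt2
  have hBF1 : (0:ℝ) ≤ (((u₁ + v₁) * (1 - y) ^ 2 + y * u₁) * ((u₂ + v₂) * (2 - y) - u₂)) := mul_nonneg hP1 hQt2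
  have k1 : (1 / 16 + y - 3 / 8 * u₁ - 1 / 4 * v₁ + 1 / 8 * u₂ + 3 / 8 * v₂ + 13 / 16 * y ^ 2 - 11 / 8 * y * u₁ - 25 / 16 * y * v₁ - 5 / 4 * y * u₂ -
        33 / 16 * y * v₂ + 7 / 16 * u₁ ^ 2 + 11 / 16 * u₁ * v₁ + 9 / 16 * u₁ * u₂ + 5 / 8 * u₁ * v₂ + 1 / 16 * v₁ ^ 2 + 13 / 16 * v₁ * u₂ + 9 / 8 * v₁
        * v₂ - 3 / 8 * u₂ ^ 2 + 13 / 16 * v₂ ^ 2) ≤ (((u₁ + v₁) * (1 - y) ^ 2 + y * u₁) * ((u₂ + v₂) * (2 - y) - u₂)) * t₁ := tbc_block_le _ _ _ _ _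
        hBF1 hD1 hT1 b1
  have hBF2 : (0:ℝ) ≤ (((u₁ + v₁) * (2 - y) - u₁) * ((u₂ + v₂) * (1 - y) ^ 2 + y * u₂)) := mul_nonneg hQt1 hP2
  have k2 : (-1 / 16 - 1 / 16 * y + 13 / 16 * u₁ + 3 / 8 * v₁ - 7 / 16 * u₂ - 3 / 2 * v₂ + 9 / 16 * y * u₁ - 15 / 8 * y * u₂ - 5 / 2 * y * v₂ - 15 /
        16 * u₁ ^ 2 - 25 / 16 * u₁ * v₁ + 17 / 16 * u₁ * u₂ + 21 / 8 * u₁ * v₂ - 1 / 8 * v₁ ^ 2 + 2 * v₁ * u₂ + 55 / 16 * v₁ * v₂ + 1 / 8 * u₂ ^ 2 - 1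
        / 16 * u₂ * v₂ - 5 / 16 * v₂ ^ 2) ≤ (((u₁ + v₁) * (2 - y) - u₁) * ((u₂ + v₂) * (1 - y) ^ 2 + y * u₂)) * t₂ := tbc_block_le _ _ _ _ _ hBF2 hD2
        hT2 b2
  have hB0 : (0:ℝ) ≤ (y * (((u₁ + v₁) * (2 - y) - u₁) * ((u₂ + v₂) * (2 - y) - u₂))) := mul_nonneg hy0.le (mul_nonneg hQt1 hQt2)
  have k0 : (-5 / 8 * u₁ * u₂ - 5 / 4 * u₁ * v₂ - 13 / 16 * v₁ * u₂ - 25 / 16 * v₁ * v₂ - 3 * y * u₁ * u₂ - 4 * y * u₁ * v₂ + 2 * y ^ 2 * u₁ * u₂ + 3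
        * y ^ 2 * u₁ * v₂ - y ^ 3 * u₁ * u₂ - y ^ 3 * u₁ * v₂ - 4 * y * v₁ * u₂ - 6 * y * v₁ * v₂ + 3 * y ^ 2 * v₁ * u₂ + 4 * y ^ 2 * v₁ * v₂ - y ^ 3
        * v₁ * u₂ - y ^ 3 * v₁ * v₂ - 15 / 16 * y - 7 / 16 * u₁ - 1 / 8 * v₁ + 5 / 16 * u₂ + 9 / 8 * v₂ - 13 / 16 * y ^ 2 + 13 / 16 * y * u₁ + 25 / 16
        * y * v₁ + 25 / 8 * y * u₂ + 73 / 16 * y * v₂ + 1 / 2 * u₁ ^ 2 + 7 / 8 * u₁ * v₁ + 1 / 16 * v₁ ^ 2 + 1 / 4 * u₂ ^ 2 - 1 / 2 * v₂ ^ 2 + 1 / 16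
        * u₂ * v₂) ≤ (y * (((u₁ + v₁) * (2 - y) - u₁) * ((u₂ + v₂) * (2 - y) - u₂))) * t₀ := b0.trans (mul_nonneg hB0 hT0)
  have e : y * ((1 / 16 + y - 3 / 8 * u₁ - 1 / 4 * v₁ + 1 / 8 * u₂ + 3 / 8 * v₂ + 13 / 16 * y ^ 2 - 11 / 8 * y * u₁ - 25 / 16 * y * v₁ - 5 / 4 * y *
        u₂ - 33 / 16 * y * v₂ + 7 / 16 * u₁ ^ 2 + 11 / 16 * u₁ * v₁ + 9 / 16 * u₁ * u₂ + 5 / 8 * u₁ * v₂ + 1 / 16 * v₁ ^ 2 + 13 / 16 * v₁ * u₂ + 9 / 8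
        * v₁ * v₂ - 3 / 8 * u₂ ^ 2 + 13 / 16 * v₂ ^ 2) + (-1 / 16 - 1 / 16 * y + 13 / 16 * u₁ + 3 / 8 * v₁ - 7 / 16 * u₂ - 3 / 2 * v₂ + 9 / 16 * y *
        u₁ - 15 / 8 * y * u₂ - 5 / 2 * y * v₂ - 15 / 16 * u₁ ^ 2 - 25 / 16 * u₁ * v₁ + 17 / 16 * u₁ * u₂ + 21 / 8 * u₁ * v₂ - 1 / 8 * v₁ ^ 2 + 2 * v₁
        * u₂ + 55 / 16 * v₁ * v₂ + 1 / 8 * u₂ ^ 2 - 1 / 16 * u₂ * v₂ - 5 / 16 * v₂ ^ 2) + (-5 / 8 * u₁ * u₂ - 5 / 4 * u₁ * v₂ - 13 / 16 * v₁ * u₂ - 25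
        / 16 * v₁ * v₂ - 3 * y * u₁ * u₂ - 4 * y * u₁ * v₂ + 2 * y ^ 2 * u₁ * u₂ + 3 * y ^ 2 * u₁ * v₂ - y ^ 3 * u₁ * u₂ - y ^ 3 * u₁ * v₂ - 4 * y *
        v₁ * u₂ - 6 * y * v₁ * v₂ + 3 * y ^ 2 * v₁ * u₂ + 4 * y ^ 2 * v₁ * v₂ - y ^ 3 * v₁ * u₂ - y ^ 3 * v₁ * v₂ - 15 / 16 * y - 7 / 16 * u₁ - 1 / 8
        * v₁ + 5 / 16 * u₂ + 9 / 8 * v₂ - 13 / 16 * y ^ 2 + 13 / 16 * y * u₁ + 25 / 16 * y * v₁ + 25 / 8 * y * u₂ + 73 / 16 * y * v₂ + 1 / 2 * u₁ ^ 2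
        + 7 / 8 * u₁ * v₁ + 1 / 16 * v₁ ^ 2 + 1 / 4 * u₂ ^ 2 - 1 / 2 * v₂ ^ 2 + 1 / 16 * u₂ * v₂)) = (1 - y) * ((u₁ + v₁) * (u₂ + v₂)) - ((u₁ + v₁) *
        (1 - y) ^ 2 + y * u₁) * ((u₂ + v₂) * (1 - y) ^ 2 + y * u₂) := by ring
  have hsum := mul_le_mul_of_nonneg_left (add_le_add (add_le_add k1 k2) k0) hy0.le
  calc (1 - y) * ((u₁ + v₁) * (u₂ + v₂)) = ((u₁ + v₁) * (1 - y) ^ 2 + y * u₁) * ((u₂ + v₂) * (1 - y) ^ 2 + y * u₂) + y * ((1 / 16 + y - 3 / 8 * u₁ - 1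
        / 4 * v₁ + 1 / 8 * u₂ + 3 / 8 * v₂ + 13 / 16 * y ^ 2 - 11 / 8 * y * u₁ - 25 / 16 * y * v₁ - 5 / 4 * y * u₂ - 33 / 16 * y * v₂ + 7 / 16 * u₁ ^
        2 + 11 / 16 * u₁ * v₁ + 9 / 16 * u₁ * u₂ + 5 / 8 * u₁ * v₂ + 1 / 16 * v₁ ^ 2 + 13 / 16 * v₁ * u₂ + 9 / 8 * v₁ * v₂ - 3 / 8 * u₂ ^ 2 + 13 / 16
        * v₂ ^ 2) + (-1 / 16 - 1 / 16 * y + 13 / 16 * u₁ + 3 / 8 * v₁ - 7 / 16 * u₂ - 3 / 2 * v₂ + 9 / 16 * y * u₁ - 15 / 8 * y * u₂ - 5 / 2 * y * v₂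
        - 15 / 16 * u₁ ^ 2 - 25 / 16 * u₁ * v₁ + 17 / 16 * u₁ * u₂ + 21 / 8 * u₁ * v₂ - 1 / 8 * v₁ ^ 2 + 2 * v₁ * u₂ + 55 / 16 * v₁ * v₂ + 1 / 8 * u₂
        ^ 2 - 1 / 16 * u₂ * v₂ - 5 / 16 * v₂ ^ 2) + (-5 / 8 * u₁ * u₂ - 5 / 4 * u₁ * v₂ - 13 / 16 * v₁ * u₂ - 25 / 16 * v₁ * v₂ - 3 * y * u₁ * u₂ - 4
        * y * u₁ * v₂ + 2 * y ^ 2 * u₁ * u₂ + 3 * y ^ 2 * u₁ * v₂ - y ^ 3 * u₁ * u₂ - y ^ 3 * u₁ * v₂ - 4 * y * v₁ * u₂ - 6 * y * v₁ * v₂ + 3 * y ^ 2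
        * v₁ * u₂ + 4 * y ^ 2 * v₁ * v₂ - y ^ 3 * v₁ * u₂ - y ^ 3 * v₁ * v₂ - 15 / 16 * y - 7 / 16 * u₁ - 1 / 8 * v₁ + 5 / 16 * u₂ + 9 / 8 * v₂ - 13 /
        16 * y ^ 2 + 13 / 16 * y * u₁ + 25 / 16 * y * v₁ + 25 / 8 * y * u₂ + 73 / 16 * y * v₂ + 1 / 2 * u₁ ^ 2 + 7 / 8 * u₁ * v₁ + 1 / 16 * v₁ ^ 2 + 1
        / 4 * u₂ ^ 2 - 1 / 2 * v₂ ^ 2 + 1 / 16 * u₂ * v₂)) := by rw [e]; ring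
    _ ≤ ((u₁ + v₁) * (1 - y) ^ 2 + y * u₁) * ((u₂ + v₂) * (1 - y) ^ 2 + y * u₂) + y * ((((u₁ + v₁) * (1 - y) ^ 2 + y * u₁) * ((u₂ + v₂) * (2 - y) -
          u₂)) * t₁ + (((u₁ + v₁) * (2 - y) - u₁) * ((u₂ + v₂) * (1 - y) ^ 2 + y * u₂)) * t₂ + (y * (((u₁ + v₁) * (2 - y) - u₁) * ((u₂ + v₂) * (2 - y)
          - u₂))) * t₀) := add_le_add le_rfl hsum
    _ = _ := by ring

end IndepBlob

end Quant

end Summit.CriticalPhenomena.PercolationContinuityZ3.Theorems
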